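import Summits.ResolutionOfSingularities.ResolutionOfSingularities.Theorems.TowerCutShape

/-!
# TowerCut (T3/8) — the two blow-up charts of a Σ-stage (`ShapeData.zChart`, `ShapeData.uChart`)

see `Theorems/MaxContactCutTowerCut.lean` (slice T8) for the main theorem `spreadExit_holds : SpreadExit`, the mechanism and the
sources ([Hironaka1964], [CossartJannsenSaito2020], [CutkoskyBook2004] §7).  `decomp-res-lens-2` g29, node «TowerCut».
-/

open CategoryTheory AlgebraicGeometry IsLocalRing TopologicalSpace Topology
open Literature.AlgebraicGeometry.Resolution
open Summit.ResolutionOfSingularities.ResolutionOfSingularities.Theorems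
open Summit.ResolutionOfSingularities.ResolutionOfSingularities.Theorems.WeakOrderReduction
open Summit.ResolutionOfSingularities.ResolutionOfSingularities.Theorems.DeltaFaceCutClasses
open Summit.ResolutionOfSingularities.ResolutionOfSingularities.Theorems.RelativeDeltaCut
open Summit.ResolutionOfSingularities.ResolutionOfSingularities.Theorems.SpreadCut

namespace Summit.ResolutionOfSingularities.ResolutionOfSingularities.Theorems.TowerCut

/-! ## §C  THE Σ-CHART STEP (ring level): over a point carrying stage shape data with `n < a`, blow up the Σ-stalk
`(z, u)`; at a point `x'` of the blow-up presented by the chart dictionary (`BlowupStalkCharts`), the controlled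
transform `(J𝒪 : tⁿ)` is the unit ideal (the `z`-chart, and the `u`-chart off `e₀ ∈ 𝔴`) or carries stage shape data
with `a - n` (the `u`-chart at `e₀ ∈ 𝔴`). -/

section Chart

variable {A : Type} [CommRing A] [IsRegularLocalRing A] {J E : Ideal A} {n a : ℕ}

omit [IsRegularLocalRing A] in
/-- Membership in the controlled transform `(J S : tⁿ)` from a factorisation `σ f = tⁿ f'`. [folklore] -/
theorem mem_colon_of_map_eq {S : Type} [CommRing S] (σ : A →+* S) {f : A} (hf : f ∈ J) {t f' : S} {n : ℕ}
    (h : σ f = t ^ n * f') : f' ∈ Submodule.colon (J.map σ) ((Ideal.span {t} ^ n : Ideal S) : Set S) := by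
  rw [Submodule.mem_colon]
  intro s hs
  rw [Ideal.span_singleton_pow, SetLike.mem_coe] at hs
  obtain ⟨w, rfl⟩ := Ideal.mem_span_singleton'.mp hs
  have : f' • (w * t ^ n) = w * σ f := by rw [h, smul_eq_mul]; ring
  rw [this]
  exact Ideal.mul_mem_left _ _ (Ideal.mem_map_of_mem σ hf)

/-- A unit plus an element of the maximal ideal is a unit. [folklore] -/
theorem isUnit_add_of_mem {S : Type} [CommRing S] [IsLocalRing S] {v m : S} (hv : IsUnit v)
    (hm : m ∈ maximalIdeal S) : IsUnit (v + m) := by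
  rw [← IsLocalRing.notMem_maximalIdeal] at hv ⊢
  intro h
  exact hv (by simpa using Ideal.sub_mem _ h hm)

/-- In the `u`-chart at a prime `𝔴 ∋ e₀`: `(e₀, u)` is part of a regular system of parameters. [folklore] -/
theorem isRsopPart_pair_uChart (c : Fin 2 → A) {l : ℕ} (W : Fin l → A)
    (hW : Ideal.span (Set.range (Fin.append c W)) = maximalIdeal A)
    (hd : (maximalIdeal A).spanFinrank = 2 + l) (𝔴 : PrimeSpectrum (chartRing c 1)) (S : Type) [CommRing S]
    [IsLocalRing S] [Algebra (chartRing c 1) S] [IsLocalization.AtPrime S 𝔴.asIdeal]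
    (h𝔴 : 𝔴.asIdeal.comap (chartBase c 1) = maximalIdeal A) (h0 : chartGen c 1 0 ∈ 𝔴.asIdeal) :
    IsRsopPart ![(algebraMap (chartRing c 1) S : chartRing c 1 →+* S) (chartGen c 1 0),
      (algebraMap (chartRing c 1) S : chartRing c 1 →+* S) (chartBase c 1 (c 1))] := by
  have jJinj : Function.Injective (fun _ : Fin 1 => (⟨0, by decide⟩ : {j : Fin 2 // j ≠ 1})) :=
    fun a b _ => Subsingleton.elim a b
  have hfam := isRsopPart_chartFamily_reesChart (c := c) (i := 1) W hW hd 𝔴.asIdeal h𝔴 S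
    (fun _ : Fin 1 => ⟨0, by decide⟩) jJinj (fun _ => h0)
  have hι : Function.Injective ![Fin.succ (Fin.castAdd l (0 : Fin 1)), (0 : Fin (1 + l + 1))] := by
    intro a b h
    fin_cases a <;> fin_cases b
    · rfl
    · exact absurd h (by simp [Fin.succ_ne_zero])
    · exact absurd h.symm (by simp [Fin.succ_ne_zero])
    · rfl
  have h2 := hfam.comp _ hι
  convert h2 using 1
  funext k
  fin_cases k
  · simp [chartFamily]
  · simp [chartFamily]

/-- In the `u`-chart at a prime `𝔴 ∋ e₀`: `(e₀, u, w_k)` is part of a regular system of parameters. [folklore] -/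
theorem isRsopPart_triple_uChart (c : Fin 2 → A) {l : ℕ} (W : Fin l → A) (k : Fin l)
    (hW : Ideal.span (Set.range (Fin.append c W)) = maximalIdeal A)
    (hd : (maximalIdeal A).spanFinrank = 2 + l) (𝔴 : PrimeSpectrum (chartRing c 1)) (S : Type) [CommRing S]
    [IsLocalRing S] [Algebra (chartRing c 1) S] [IsLocalization.AtPrime S 𝔴.asIdeal]
    (h𝔴 : 𝔴.asIdeal.comap (chartBase c 1) = maximalIdeal A) (h0 : chartGen c 1 0 ∈ 𝔴.asIdeal) :
    IsRsopPart ![(algebraMap (chartRing c 1) S : chartRing c 1 →+* S) (chartGen c 1 0),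
      (algebraMap (chartRing c 1) S : chartRing c 1 →+* S) (chartBase c 1 (c 1)),
      (algebraMap (chartRing c 1) S : chartRing c 1 →+* S) (chartBase c 1 (W k))] := by
  have jJinj : Function.Injective (fun _ : Fin 1 => (⟨0, by decide⟩ : {j : Fin 2 // j ≠ 1})) :=
    fun a b _ => Subsingleton.elim a b
  have hfam := isRsopPart_chartFamily_reesChart (c := c) (i := 1) W hW hd 𝔴.asIdeal h𝔴 S
    (fun _ : Fin 1 => ⟨0, by decide⟩) jJinj (fun _ => h0)
  have hι : Function.Injective
      ![Fin.succ (Fin.castAdd l (0 : Fin 1)), (0 : Fin (1 + l + 1)), Fin.succ (Fin.natAdd 1 k)] := by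
    intro a b h
    fin_cases a <;> fin_cases b <;>
      first
      | rfl
      | (exfalso; simp [Fin.ext_iff] at h; try omega)
  have h3 := hfam.comp _ hι
  convert h3 using 1
  funext j
  fin_cases j
  · simp [chartFamily]
  · simp [chartFamily]
  · simp [chartFamily]

/-- **The `z`-chart**: `(J𝒪 : tⁿ) = (1)` (`f/zⁿ = 1 + z^{a-n} e₁ᵃ φ + z·r` is a unit). [folklore] -/
theorem ShapeData.zChart (D : ShapeData J E n a) (hna : n < a) (c : Fin 2 → A)
    (hc : c = ![D.z, D.u]) (𝔴 : PrimeSpectrum (chartRing c 0)) {S : Type} [CommRing S] [IsLocalRing S]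
    (χ : chartRing c 0 →+* S) (hlocχ : @IsLocalization.AtPrime _ _ S _ χ.toAlgebra 𝔴.asIdeal _)
    (h𝔴 : 𝔴.asIdeal.comap (chartBase c 0) = maximalIdeal A)
    (σ : A →+* S) (hσ : ∀ x, χ (chartBase c 0 x) = σ x) :
    Submodule.colon (J.map σ) ((Ideal.span {σ (c 0)} ^ n : Ideal S) : Set S) = ⊤ := by
  letI := χ.toAlgebra
  haveI : IsLocalization.AtPrime S 𝔴.asIdeal := hlocχ
  have halg : ∀ b, algebraMap (chartRing c 0) S b = χ b := fun b =>
    RingHom.congr_fun (RingHom.algebraMap_toAlgebra χ) b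
  have hz0 : c 0 = D.z := by rw [hc]; rfl
  have hu1 : c 1 = D.u := by rw [hc]; rfl
  set ε : Fin 2 → S := fun l => χ (chartGen c 0 l) with hε
  have hu : ∀ l, σ (c l) = σ (c 0) * ε l := fun l => by
    rw [hε, ← hσ, ← hσ, ← map_mul, ← reesChartBase_apply_eq_mul_chartGen c 0 l]
  have hloc : ∀ x : A, σ x ∈ maximalIdeal S ↔ x ∈ maximalIdeal A := fun x => by
    rw [← hσ, ← halg, IsLocalization.AtPrime.to_map_mem_maximal_iff S 𝔴.asIdeal, ← Ideal.mem_comap, h𝔴]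
  set t := σ (c 0) with ht
  have htm : t ∈ maximalIdeal S := (hloc _).mpr (hz0 ▸ D.z_mem)
  obtain ⟨a', ha'⟩ : ∃ a', a = n + 1 + a' := ⟨a - (n + 1), by omega⟩
  -- `σ g ∈ (t^{n+1})`
  have hgP : D.g ∈ Ideal.span (Set.range c) ^ (n + 1) :=
    qWeighted_le_pow_of_lt c hna.le (N := n) (l := n * a + 1) (by omega) (by rw [hc]; exact D.tail)
  have hσg : σ D.g ∈ Ideal.span {t ^ (n + 1)} := by
    have h := Ideal.mem_map_of_mem σ hgP
    rwa [Ideal.map_pow, Ideal.map_span_range_eq_span_singleton σ c 0 ε hu, Ideal.span_singleton_pow] at h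
  obtain ⟨r, hr⟩ := Ideal.mem_span_singleton'.mp hσg
  -- `σ f = tⁿ · (1 + t^{1+a'} ε₁ᵃ σφ + t r)`
  have hσu : σ D.u = t * ε 1 := by rw [← hu1, hu 1]
  have hσz : σ D.z = t := by rw [← hz0]
  have hf' : σ (D.z ^ n + D.u ^ a * D.φ + D.g) = t ^ n * (1 + t ^ (1 + a') * ε 1 ^ a * σ D.φ + t * r) := by
    simp only [map_add, map_mul, map_pow, hσu, hσz, ← hr, ha']
    ring
  have hmem := mem_colon_of_map_eq σ D.mem hf'
  refine Ideal.eq_top_of_isUnit_mem _ hmem ?_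
  rw [add_assoc]
  refine isUnit_add_of_mem isUnit_one (Ideal.add_mem _ ?_ (Ideal.mul_mem_right _ _ htm))
  rw [pow_add, pow_one, mul_assoc, mul_assoc]
  exact Ideal.mul_mem_right _ _ htm

/-- **The `u`-chart**: either `(J𝒪 : tⁿ) = (1)` (off `e₀ ∈ 𝔴`) or stage shape data with `a - n` (at `e₀ ∈ 𝔴`):
`z' = e₀`, `u' = t = σ u`, `φ' = σ φ`, the tail from the chart law, `J' ⊆ Q'(n(a-n))` by the chart law and the colon,
and the parameters by `isRsopPart_chartFamily_reesChart`. [folklore] -/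
theorem ShapeData.uChart (D : ShapeData J E n a) (hn : 1 ≤ n) (hna : n < a) (c : Fin 2 → A)
    (hc : c = ![D.z, D.u]) (𝔴 : PrimeSpectrum (chartRing c 1)) {S : Type} [CommRing S] [IsLocalRing S]
    (χ : chartRing c 1 →+* S) (hlocχ : @IsLocalization.AtPrime _ _ S _ χ.toAlgebra 𝔴.asIdeal _)
    (h𝔴 : 𝔴.asIdeal.comap (chartBase c 1) = maximalIdeal A)
    (σ : A →+* S) (hσ : ∀ x, χ (chartBase c 1 x) = σ x) :
    Submodule.colon (J.map σ) ((Ideal.span {σ (c 1)} ^ n : Ideal S) : Set S) = ⊤ ∨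
      Nonempty (ShapeData (Submodule.colon (J.map σ) ((Ideal.span {σ (c 1)} ^ n : Ideal S) : Set S))
        (Ideal.span {σ (c 1)}) n (a - n)) := by
  letI := χ.toAlgebra
  haveI : IsLocalization.AtPrime S 𝔴.asIdeal := hlocχ
  have halg : ∀ b, algebraMap (chartRing c 1) S b = χ b := fun b =>
    RingHom.congr_fun (RingHom.algebraMap_toAlgebra χ) b
  have hz0 : c 0 = D.z := by rw [hc]; rfl
  have hu1 : c 1 = D.u := by rw [hc]; rfl
  have hrs : IsRsopPart c := by rw [hc]; exact D.rsop
  set ε : Fin 2 → S := fun l => χ (chartGen c 1 l) with hε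
  have hu : ∀ l, σ (c l) = σ (c 1) * ε l := fun l => by
    rw [hε, ← hσ, ← hσ, ← map_mul, ← reesChartBase_apply_eq_mul_chartGen c 1 l]
  have hloc : ∀ x : A, σ x ∈ maximalIdeal S ↔ x ∈ maximalIdeal A := fun x => by
    rw [← hσ, ← halg, IsLocalization.AtPrime.to_map_mem_maximal_iff S 𝔴.asIdeal, ← Ideal.mem_comap, h𝔴]
  set t := σ (c 1) with ht
  have htm : t ∈ maximalIdeal S := (hloc _).mpr (hu1 ▸ D.u_mem)
  have hσz : σ D.z = t * ε 0 := by rw [← hz0, hu 0]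
  have hσu : σ D.u = t := by rw [← hu1]
  obtain ⟨a', ha'⟩ : ∃ a', a = n + a' := ⟨a - n, by omega⟩
  have ha'1 : 1 ≤ a' := by omega
  have han : a - n = a' := by omega
  rw [han]
  -- the chart law: `J S ⊆ tⁿ · Q'(n a')`, `σ g ∈ tⁿ · Q'(n a' + 1)`
  have hlaw1 := map_qWeighted_le_chart σ c 1 ε hu (a := a) (b := n) (l := n * a) (N := n) hna.le (by omega)
    le_rfl
  have hlaw2 := map_qWeighted_le_chart σ c 1 ε hu (a := a) (b := n) (l := n * a + 1) (N := n) hna.le (by omega)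
    (by omega)
  have hl1 : n * a - n * n = n * a' := by rw [ha', Nat.mul_add]; omega
  have hl2 : n * a + 1 - n * n = n * a' + 1 := by rw [ha', Nat.mul_add]; omega
  rw [hl1, han] at hlaw1
  rw [hl2, han] at hlaw2
  have hdeep : J ≤ qWeighted c a n (n * a) := by rw [hc]; exact D.deep
  have htail : D.g ∈ qWeighted c a n (n * a + 1) := by rw [hc]; exact D.tail
  have hJ' : J.map σ ≤ Ideal.span {t ^ n} * qWeighted ![ε 0, t] a' n (n * a') := (Ideal.map_mono hdeep).trans hlaw1
  obtain ⟨g'', hg'', hg''e⟩ := Ideal.mem_span_singleton_mul.mp (hlaw2 (Ideal.mem_map_of_mem σ htail))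
  -- `σ g ∈ (t^{n+1})` as well
  have hgP : D.g ∈ Ideal.span (Set.range c) ^ (n + 1) :=
    qWeighted_le_pow_of_lt c hna.le (N := n) (l := n * a + 1) (by omega) htail
  have hσg : σ D.g ∈ Ideal.span {t ^ (n + 1)} := by
    have h := Ideal.mem_map_of_mem σ hgP
    rwa [Ideal.map_pow, Ideal.map_span_range_eq_span_singleton σ c 1 ε hu, Ideal.span_singleton_pow] at h
  obtain ⟨r, hr⟩ := Ideal.mem_span_singleton'.mp hσg
  by_cases h0 : chartGen c 1 0 ∈ 𝔴.asIdeal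
  · -- stage shape data with `a'`
    right
    -- the parameters `(e₀, t)` and `(e₀, t, σφ)`
    have hrsop2 : IsRsopPart ![ε 0, t] := by
      obtain ⟨e, y, hd, hy⟩ := exists_append_of_isRsopPart hrs
      have h := isRsopPart_pair_uChart c y hy hd 𝔴 S h𝔴 h0
      simpa only [halg, hσ, hε, ht] using h
    have hrsop3 : σ D.φ ∈ maximalIdeal S → IsRsopPart ![ε 0, t, σ D.φ] := fun hφ => by
      have hφA : D.φ ∈ maximalIdeal A := (hloc _).mp hφ
      obtain ⟨e, y, hd, hy⟩ := exists_append_of_isRsopPart (D.simple hφA)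
      have hy' : Ideal.span (Set.range (Fin.append c (Fin.append ![D.φ] y))) = maximalIdeal A := by
        rw [← hy]
        simp only [range_fin_append, hc, Matrix.range_cons, Matrix.range_empty, Set.union_empty, Set.union_assoc]
      have hd' : (maximalIdeal A).spanFinrank = 2 + (1 + e) := by rw [hd]; ring
      have h := isRsopPart_triple_uChart c (Fin.append ![D.φ] y) (Fin.castAdd e 0) hy' hd' 𝔴 S h𝔴 h0
      simpa only [halg, hσ, hε, ht, Fin.append_left, Matrix.cons_val_zero, Matrix.cons_val_fin_one] using h
    -- `t` is a non-zero-divisor of the regular local ring `S`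
    haveI : IsRegularLocalRing S := hrsop2.isRegularLocalRing
    haveI := isDomain_of_isRegularLocalRing S
    have ht0 : t ∈ nonZeroDivisors S := mem_nonZeroDivisors_of_ne_zero (hrsop2.ne_zero 1)
    have hf' : σ (D.z ^ n + D.u ^ a * D.φ + D.g) = t ^ n * (ε 0 ^ n + t ^ a' * σ D.φ + g'') := by
      simp only [map_add, map_mul, map_pow, hσz, hσu, ← hg''e, ha']
      ring
    exact ⟨{ z := ε 0
             u := t
             φ := σ D.φ
             g := g''
             rsop := hrsop2
             exc := rfl
             mem := mem_colon_of_map_eq σ D.mem hf'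
             tail := hg''
             deep := colon_le_of_le_span_pow_mul ht0 hJ'
             simple := hrsop3 }⟩
  · -- `e₀` is a unit: `f/uⁿ` is a unit
    left
    have hunit : IsUnit (ε 0) := by
      rw [hε]; dsimp only; rw [← halg]
      exact IsLocalization.map_units S (⟨chartGen c 1 0, h0⟩ : 𝔴.asIdeal.primeCompl)
    have hf' : σ (D.z ^ n + D.u ^ a * D.φ + D.g) = t ^ n * (ε 0 ^ n + t ^ a' * σ D.φ + t * r) := by
      simp only [map_add, map_mul, map_pow, hσz, hσu, ← hr, ha']
      ring
    refine Ideal.eq_top_of_isUnit_mem _ (mem_colon_of_map_eq σ D.mem hf') ?_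
    rw [add_assoc]
    refine isUnit_add_of_mem (hunit.pow n) (Ideal.add_mem _ ?_ (Ideal.mul_mem_right _ _ htm))
    obtain ⟨a'', rfl⟩ : ∃ a'', a' = a'' + 1 := ⟨a' - 1, by omega⟩
    rw [pow_succ, mul_assoc]
    exact Ideal.mul_mem_left _ _ (Ideal.mul_mem_right _ _ htm)

end Chart

end Summit.ResolutionOfSingularities.ResolutionOfSingularities.Theorems.TowerCut
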